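import Summits.AtomisticToContinuum.HydrodynamicLimit.Theses.JParityClosure
import Literature.MathematicalPhysics.KineticTheory.HardSphereEulerProofs
import Literature.NumberTheory.Sieve.BombieriAsymptoticSieveMertens
import HarnessLib

/-!
# The Metropolis acceptance defect of a spiked kernel density estimate: pointwise control (line `KineticSlabSketch`, pieces K1c of P4)

Crux `JParityClosure.OddContactSymmetry` (stmt-AtomisticToContinuum-17722, rev 5), line `KineticSlabSketch`, lead
`prover-line-stmt-AtomisticToContinuum-17722-c2-0` (cycle 3).  Deterministic core of the Maxwell-defect bound P4
(`stub_maxwellDefectFlux`): the acceptance defect `δ = 1 − min(1, e^{−F})` of the Metropolis weight, with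
`F = log h(a) + log h(b) − log h(a⁺) − log h(b⁺)` the surprisal jump of the mollified one-body law `h` between the pre
(`a, b`) and post (`a⁺, b⁺`) velocities of a collision, is controlled LINEARLY by the relative deviations
`Δ_q = h₀(q)/m̄(q) − 1` of the leave-two-out part `h₀` from a twisted-balanced reference `m̄` at the four velocities and by the
self-spike terms `S/m̄` at the pre velocities (`metropolisDefect_le`: post spikes only lower `F`, pre spikes cost
`log(1 + S/h₀)`, `min(1,|Σ ± log(1+Δ_q)|) ≤ 2Σ|Δ_q|` always).  Instantiated on the weighted Gaussian KDE of the crux with the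
reference `P · M_{θ+ϑ²}` (balanced by energy conservation of `reflectVel`, `localMaxwellian_mul_eq_of_norm_sq`) this is
`defect_pointwise_le`, the pointwise input of the velocity-level bound K1 (`stub_kdeDefectPair`).
-/

noncomputable section

open scoped BigOperators Classical InnerProductSpace ENNReal Topology
open Set MeasureTheory Filter Function
open Literature.Analysis.FluidPDE Literature.MathematicalPhysics.KineticTheory

namespace Summit.AtomisticToContinuum.HydrodynamicLimit.Theorems.OddContactSymmetryKineticSlab



/-- `min 1 t ≤ min 1 u + min 1 w + min 1 z` whenever `t ≤ u + w + z` and `u, w, z ≥ 0`. [folklore] -/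
theorem min_one_le_add_three {t u w z : ℝ} (hu : 0 ≤ u) (hw : 0 ≤ w) (hz : 0 ≤ z) (h : t ≤ u + w + z) :
    min 1 t ≤ min 1 u + min 1 w + min 1 z := by
  rcases le_or_gt 1 u with hu1 | hu1
  · rw [min_eq_left hu1]
    have := min_le_left (1 : ℝ) t
    have h2 : 0 ≤ min 1 w := le_min zero_le_one hw
    have h3 : 0 ≤ min 1 z := le_min zero_le_one hz
    linarith
  rcases le_or_gt 1 w with hw1 | hw1
  · rw [min_eq_left hw1]
    have := min_le_left (1 : ℝ) t
    have h2 : 0 ≤ min 1 u := le_min zero_le_one hu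
    have h3 : 0 ≤ min 1 z := le_min zero_le_one hz
    linarith
  rcases le_or_gt 1 z with hz1 | hz1
  · rw [min_eq_left hz1]
    have := min_le_left (1 : ℝ) t
    have h2 : 0 ≤ min 1 u := le_min zero_le_one hu
    have h3 : 0 ≤ min 1 w := le_min zero_le_one hw
    linarith
  rw [min_eq_right hu1.le, min_eq_right hw1.le, min_eq_right hz1.le]
  exact (min_le_right _ _).trans h

/-- The four-point log-deviation bound: if `m̄(a) m̄(b) = m̄(a⁺) m̄(b⁺)` (all positive) and `h_q > 0`, then with
`Δ_q = h_q/m̄_q − 1`, `min 1 |log h_a + log h_b − log h_{a⁺} − log h_{b⁺}| ≤ 2(|Δ_a| + |Δ_b| + |Δ_{a⁺}| + |Δ_{b⁺}|)`.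
[folklore] -/
theorem min_one_abs_logRatio_le {ha hb hc hd ma mb mc md : ℝ} (hha : 0 < ha) (hhb : 0 < hb) (hhc : 0 < hc)
    (hhd : 0 < hd) (hma : 0 < ma) (hmb : 0 < mb) (hmc : 0 < mc) (hmd : 0 < md) (hbal : ma * mb = mc * md) :
    min 1 |Real.log ha + Real.log hb - Real.log hc - Real.log hd| ≤
      2 * (|ha / ma - 1| + |hb / mb - 1| + |hc / mc - 1| + |hd / md - 1|) := by
  -- rewrite the log-ratio through the balanced reference
  have key : Real.log ha + Real.log hb - Real.log hc - Real.log hd =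
      Real.log (1 + (ha / ma - 1)) + Real.log (1 + (hb / mb - 1)) -
        Real.log (1 + (hc / mc - 1)) - Real.log (1 + (hd / md - 1)) := by
    have e1 : (1 : ℝ) + (ha / ma - 1) = ha / ma := by ring
    have e2 : (1 : ℝ) + (hb / mb - 1) = hb / mb := by ring
    have e3 : (1 : ℝ) + (hc / mc - 1) = hc / mc := by ring
    have e4 : (1 : ℝ) + (hd / md - 1) = hd / md := by ring
    rw [e1, e2, e3, e4, Real.log_div hha.ne' hma.ne', Real.log_div hhb.ne' hmb.ne', Real.log_div hhc.ne' hmc.ne',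
      Real.log_div hhd.ne' hmd.ne']
    have hlog : Real.log ma + Real.log mb = Real.log mc + Real.log md := by
      rw [← Real.log_mul hma.ne' hmb.ne', ← Real.log_mul hmc.ne' hmd.ne', hbal]
    linarith
  rw [key]
  set x₁ := ha / ma - 1
  set x₂ := hb / mb - 1
  set x₃ := hc / mc - 1
  set x₄ := hd / md - 1
  by_cases hbig : 1 / 2 < |x₁| ∨ 1 / 2 < |x₂| ∨ 1 / 2 < |x₃| ∨ 1 / 2 < |x₄|
  · have h1 : min 1 |Real.log (1 + x₁) + Real.log (1 + x₂) - Real.log (1 + x₃) - Real.log (1 + x₄)| ≤ 1 :=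
      min_le_left _ _
    have : (1 : ℝ) ≤ 2 * (|x₁| + |x₂| + |x₃| + |x₄|) := by
      rcases hbig with h | h | h | h <;>
        linarith [abs_nonneg x₁, abs_nonneg x₂, abs_nonneg x₃, abs_nonneg x₄]
    linarith
  · push Not at hbig
    obtain ⟨h1, h2, h3, h4⟩ := hbig
    have b1 := Literature.NumberTheory.Sieve.BombieriSieve.abs_log_one_add_le h1
    have b2 := Literature.NumberTheory.Sieve.BombieriSieve.abs_log_one_add_le h2
    have b3 := Literature.NumberTheory.Sieve.BombieriSieve.abs_log_one_add_le h3
    have b4 := Literature.NumberTheory.Sieve.BombieriSieve.abs_log_one_add_le h4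
    calc min 1 |Real.log (1 + x₁) + Real.log (1 + x₂) - Real.log (1 + x₃) - Real.log (1 + x₄)|
        ≤ |Real.log (1 + x₁) + Real.log (1 + x₂) - Real.log (1 + x₃) - Real.log (1 + x₄)| := min_le_right _ _
      _ ≤ |Real.log (1 + x₁)| + |Real.log (1 + x₂)| + |Real.log (1 + x₃)| + |Real.log (1 + x₄)| := by
          set l₁ := Real.log (1 + x₁)
          set l₂ := Real.log (1 + x₂)
          set l₃ := Real.log (1 + x₃)
          set l₄ := Real.log (1 + x₄)
          have t1 : |l₁ + l₂ - l₃ - l₄| ≤ |l₁ + l₂ - l₃| + |l₄| := by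
            rw [sub_eq_add_neg (l₁ + l₂ - l₃), ← abs_neg l₄]; exact abs_add_le _ _
          have t2 : |l₁ + l₂ - l₃| ≤ |l₁ + l₂| + |l₃| := by
            rw [sub_eq_add_neg, ← abs_neg l₃]; exact abs_add_le _ _
          have t3 : |l₁ + l₂| ≤ |l₁| + |l₂| := abs_add_le _ _
          linarith
      _ ≤ 2 * (|x₁| + |x₂| + |x₃| + |x₄|) := by linarith

/-- The spike term: if `h_q > 0`, `m̄_q > 0`, `0 ≤ S`, then `min 1 (log(1 + S/h_q)) ≤ 2|h_q/m̄_q − 1| + 2 S/m̄_q`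
(if the relative deviation is below `1/2` then `h_q ≥ m̄_q/2`). [folklore] -/
theorem min_one_log_spike_le {h m S : ℝ} (hh : 0 < h) (hm : 0 < m) (hS : 0 ≤ S) :
    min 1 (Real.log (1 + S / h)) ≤ 2 * |h / m - 1| + 2 * (S / m) := by
  have hSm : 0 ≤ S / m := div_nonneg hS hm.le
  by_cases hbig : 1 / 2 < |h / m - 1|
  · have := min_le_left (1 : ℝ) (Real.log (1 + S / h))
    linarith
  · push Not at hbig
    have hlow : m / 2 ≤ h := by
      have := (abs_le.1 hbig).1
      have hdiv : 1 / 2 ≤ h / m := by linarith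
      rw [le_div_iff₀ hm] at hdiv
      linarith
    have hSh : S / h ≤ 2 * (S / m) := by
      rw [div_le_iff₀ hh]
      have : 2 * (S / m) * h = S * (2 * h / m) := by ring
      rw [this]
      have h2 : 1 ≤ 2 * h / m := by rw [le_div_iff₀ hm]; linarith
      nlinarith
    calc min 1 (Real.log (1 + S / h)) ≤ Real.log (1 + S / h) := min_le_right _ _
      _ ≤ (1 + S / h) - 1 := Real.log_le_sub_one_of_pos (by positivity)
      _ = S / h := by ring
      _ ≤ 2 * (S / m) := hSh
      _ ≤ 2 * |h / m - 1| + 2 * (S / m) := by linarith [abs_nonneg (h / m - 1)]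

/-- **K1c — deterministic control of the Metropolis acceptance defect.**  Let `hₐ, h_b` (pre) and `h_c, h_d` (post) be
the values of the mollified law at the four velocities of a collision, with `0 < h₀_q ≤ h_q` at the post points
`q = c, d` and `h_q ≤ h₀_q + S` at the pre points `q = a, b` (`S ≥ 0`: the self-spikes sit at the post velocities),
`h₀_q > 0`, and `m̄_q > 0` twisted-balanced (`m̄_a m̄_b = m̄_c m̄_d`).  Then with `Δ_q = h₀_q/m̄_q − 1`:
`1 − min 1 (exp(−(log hₐ + log h_b − log h_c − log h_d))) ≤
2(|Δ_a| + |Δ_b| + |Δ_c| + |Δ_d|) + (2|Δ_a| + 2S/m̄_a) + (2|Δ_b| + 2S/m̄_b)`. [folklore] -/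
theorem metropolisDefect_le {ha hb hc hd h0a h0b h0c h0d ma mb mc md S : ℝ}
    (hh0a : 0 < h0a) (hh0b : 0 < h0b) (hh0c : 0 < h0c) (hh0d : 0 < h0d)
    (hma : 0 < ma) (hmb : 0 < mb) (hmc : 0 < mc) (hmd : 0 < md) (hbal : ma * mb = mc * md) (hS : 0 ≤ S)
    (hpre_a : ha ≤ h0a + S) (hpre_b : hb ≤ h0b + S) (hpost_c : h0c ≤ hc) (hpost_d : h0d ≤ hd)
    (hha : 0 < ha) (hhb : 0 < hb) :
    1 - min 1 (Real.exp (-(Real.log ha + Real.log hb - Real.log hc - Real.log hd))) ≤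
      2 * (|h0a / ma - 1| + |h0b / mb - 1| + |h0c / mc - 1| + |h0d / md - 1|) +
        (2 * |h0a / ma - 1| + 2 * (S / ma)) + (2 * |h0b / mb - 1| + 2 * (S / mb)) := by
  have hhc : 0 < hc := hh0c.trans_le hpost_c
  have hhd : 0 < hd := hh0d.trans_le hpost_d
  set F := Real.log ha + Real.log hb - Real.log hc - Real.log hd with hF
  -- the three non-negative majorants
  set U := |Real.log h0a + Real.log h0b - Real.log h0c - Real.log h0d| with hU
  set La := Real.log (1 + S / h0a) with hLa
  set Lb := Real.log (1 + S / h0b) with hLb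
  have hLa0 : 0 ≤ La := Real.log_nonneg (by have := div_nonneg hS hh0a.le; linarith)
  have hLb0 : 0 ≤ Lb := Real.log_nonneg (by have := div_nonneg hS hh0b.le; linarith)
  -- `F ≤ U + La + Lb`
  have hFle : F ≤ U + La + Lb := by
    have e1 : Real.log ha ≤ Real.log h0a + La := by
      rw [hLa, ← Real.log_mul hh0a.ne' (by positivity)]
      refine Real.log_le_log hha ?_
      rw [mul_add, mul_one, mul_div_cancel₀ _ hh0a.ne']
      exact hpre_a
    have e2 : Real.log hb ≤ Real.log h0b + Lb := by
      rw [hLb, ← Real.log_mul hh0b.ne' (by positivity)]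
      refine Real.log_le_log hhb ?_
      rw [mul_add, mul_one, mul_div_cancel₀ _ hh0b.ne']
      exact hpre_b
    have e3 : Real.log h0c ≤ Real.log hc := Real.log_le_log hh0c hpost_c
    have e4 : Real.log h0d ≤ Real.log hd := Real.log_le_log hh0d hpost_d
    have e5 : Real.log h0a + Real.log h0b - Real.log h0c - Real.log h0d ≤ U := le_abs_self _
    rw [hF]; linarith
  -- `1 − min 1 (e^{−F}) ≤ min 1 F⁺ ≤ min 1 U + min 1 La + min 1 Lb`
  have hdef : 1 - min 1 (Real.exp (-F)) ≤ min 1 U + min 1 La + min 1 Lb := by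
    rcases le_or_gt F 0 with hF0 | hF0
    · have : min 1 (Real.exp (-F)) = 1 := min_eq_left (by rw [← Real.exp_zero]; exact Real.exp_le_exp.2 (by linarith))
      rw [this, sub_self]
      have h1 : 0 ≤ min 1 U := le_min zero_le_one (abs_nonneg _)
      have h2 : 0 ≤ min 1 La := le_min zero_le_one hLa0
      have h3 : 0 ≤ min 1 Lb := le_min zero_le_one hLb0
      linarith
    · have hexp : 1 - F ≤ Real.exp (-F) := by
        have := Real.add_one_le_exp (-F); linarith
      have hexp1 : Real.exp (-F) ≤ 1 := by rw [← Real.exp_zero]; exact Real.exp_le_exp.2 (by linarith)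
      have hmin : min 1 (Real.exp (-F)) = Real.exp (-F) := min_eq_right hexp1
      rw [hmin]
      have h1 : 1 - Real.exp (-F) ≤ min 1 F := by
        refine le_min ?_ ?_
        · linarith [Real.exp_pos (-F)]
        · linarith
      exact h1.trans (min_one_le_add_three (abs_nonneg _) hLa0 hLb0 hFle)
  have hUle := min_one_abs_logRatio_le hh0a hh0b hh0c hh0d hma hmb hmc hmd hbal
  have hLale := min_one_log_spike_le hh0a hma hS
  have hLble := min_one_log_spike_le hh0b hmb hS
  rw [← hU] at hUle
  rw [← hLa] at hLale
  rw [← hLb] at hLble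
  linarith


/-! ## Gaussian kernel facts -/

/-- The Gaussian kernel is maximal at its centre: `φ_s(q, u) ≤ φ_s(0, 0)` (`s > 0`). [folklore] -/
theorem localMaxwellian_le_apply_zero {s : ℝ} (hs : 0 < s) (q u : V3) :
    localMaxwellian 1 s q u ≤ localMaxwellian 1 s (0 : V3) 0 := by
  unfold localMaxwellian
  have hb : 0 ≤ (2 * Real.pi * s) ^ (-(Module.finrank ℝ V3 : ℝ) / 2) := Real.rpow_nonneg (by positivity) _
  have hexp : Real.exp (-‖u - q‖ ^ 2 / (2 * s)) ≤ Real.exp (-‖(0 : V3) - 0‖ ^ 2 / (2 * s)) := by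
    refine Real.exp_le_exp.2 ?_
    rw [sub_zero, norm_zero]
    simp only [ne_eq, OfNat.ofNat_ne_zero, not_false_eq_true, zero_pow, neg_zero, zero_div]
    exact div_nonpos_of_nonpos_of_nonneg (by nlinarith [norm_nonneg (u - q)]) (by positivity)
  exact mul_le_mul_of_nonneg_left hexp (by positivity)

/-- The centred Gaussian factorises through its value at the origin:
`M_T(q) = M_T(0) · exp(−‖q‖²/(2T))`. [folklore] -/
theorem localMaxwellian_zero_eq_mul_exp (T : ℝ) (q : V3) :
    localMaxwellian 1 T (0 : V3) q = localMaxwellian 1 T (0 : V3) 0 * Real.exp (-‖q‖ ^ 2 / (2 * T)) := by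
  unfold localMaxwellian
  simp only [sub_zero, norm_zero, one_mul, ne_eq, OfNat.ofNat_ne_zero, not_false_eq_true, zero_pow, neg_zero,
    zero_div, Real.exp_zero, mul_one]

/-- Twisted balance of the centred Gaussian under energy conservation:
`‖a‖² + ‖b‖² = ‖c‖² + ‖d‖² ⇒ M_T(a) M_T(b) = M_T(c) M_T(d)`. [folklore] -/
theorem localMaxwellian_mul_eq_of_norm_sq {T : ℝ} {a b c d : V3} (h : ‖a‖ ^ 2 + ‖b‖ ^ 2 = ‖c‖ ^ 2 + ‖d‖ ^ 2) :
    localMaxwellian 1 T (0 : V3) a * localMaxwellian 1 T (0 : V3) b =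
      localMaxwellian 1 T (0 : V3) c * localMaxwellian 1 T (0 : V3) d := by
  rw [localMaxwellian_zero_eq_mul_exp T a, localMaxwellian_zero_eq_mul_exp T b, localMaxwellian_zero_eq_mul_exp T c,
    localMaxwellian_zero_eq_mul_exp T d]
  have : Real.exp (-‖a‖ ^ 2 / (2 * T)) * Real.exp (-‖b‖ ^ 2 / (2 * T)) =
      Real.exp (-‖c‖ ^ 2 / (2 * T)) * Real.exp (-‖d‖ ^ 2 / (2 * T)) := by
    rw [← Real.exp_add, ← Real.exp_add]
    congr 1
    rw [← add_div, ← add_div]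
    congr 1
    linarith
  calc localMaxwellian 1 T (0 : V3) 0 * Real.exp (-‖a‖ ^ 2 / (2 * T)) *
        (localMaxwellian 1 T (0 : V3) 0 * Real.exp (-‖b‖ ^ 2 / (2 * T)))
      = localMaxwellian 1 T (0 : V3) 0 * localMaxwellian 1 T (0 : V3) 0 *
          (Real.exp (-‖a‖ ^ 2 / (2 * T)) * Real.exp (-‖b‖ ^ 2 / (2 * T))) := by ring
    _ = localMaxwellian 1 T (0 : V3) 0 * localMaxwellian 1 T (0 : V3) 0 *
          (Real.exp (-‖c‖ ^ 2 / (2 * T)) * Real.exp (-‖d‖ ^ 2 / (2 * T))) := by rw [this]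
    _ = _ := by ring

/-- Inverse of the centred Gaussian: `M_T(q)⁻¹ = M_T(0)⁻¹ exp(‖q‖²/(2T))`. [folklore] -/
theorem inv_localMaxwellian_zero (T : ℝ) (q : V3) :
    (localMaxwellian 1 T (0 : V3) q)⁻¹ = (localMaxwellian 1 T (0 : V3) 0)⁻¹ * Real.exp (‖q‖ ^ 2 / (2 * T)) := by
  rw [localMaxwellian_zero_eq_mul_exp T q, mul_inv, ← Real.exp_neg, neg_div, neg_neg]

/-! ## Step 1: the pointwise defect bound -/

/-- **Pointwise control of the defect** (K1c instantiated on the weighted KDE): for every velocity configuration the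
Metropolis acceptance defect is bounded by the relative deviations of the leave-two-out KDE from the balanced reference
`P · M_{θ+ϑ²}` at the four collision velocities plus the spike terms at the pre velocities. [folklore] -/
theorem defect_pointwise_le :
    ∀ {θ ϑ : ℝ} (hθ : 0 < θ) (hϑ : 0 < ϑ) {n : ℕ} {i j : Fin n} (hij : i ≠ j)
    {p : Fin n → ℝ} (hp0 : ∀ k, 0 ≤ p k) (hP : 0 < ∑ k ∈ (Finset.univ \ {i, j}), p k)
    (ω : V3) (v : Fin n → V3),
    1 - min 1 (Real.exp (-(
        Real.log (∑ k, p k * localMaxwellian 1 (ϑ ^ 2) (reflectVel ω (v i, v j)).1 (v k)) +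
        Real.log (∑ k, p k * localMaxwellian 1 (ϑ ^ 2) (reflectVel ω (v i, v j)).2 (v k)) -
        Real.log (∑ k, p k * localMaxwellian 1 (ϑ ^ 2) (v i) (v k)) -
        Real.log (∑ k, p k * localMaxwellian 1 (ϑ ^ 2) (v j) (v k))))) ≤
      2 * (|(∑ k ∈ (Finset.univ \ {i, j}), p k * localMaxwellian 1 (ϑ ^ 2) (reflectVel ω (v i, v j)).1 (v k)) /
              ((∑ k ∈ (Finset.univ \ {i, j}), p k) * localMaxwellian 1 (θ + ϑ ^ 2) 0 (reflectVel ω (v i, v j)).1) - 1| +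
           |(∑ k ∈ (Finset.univ \ {i, j}), p k * localMaxwellian 1 (ϑ ^ 2) (reflectVel ω (v i, v j)).2 (v k)) /
              ((∑ k ∈ (Finset.univ \ {i, j}), p k) * localMaxwellian 1 (θ + ϑ ^ 2) 0 (reflectVel ω (v i, v j)).2) - 1| +
           |(∑ k ∈ (Finset.univ \ {i, j}), p k * localMaxwellian 1 (ϑ ^ 2) (v i) (v k)) /
              ((∑ k ∈ (Finset.univ \ {i, j}), p k) * localMaxwellian 1 (θ + ϑ ^ 2) 0 (v i)) - 1| +
           |(∑ k ∈ (Finset.univ \ {i, j}), p k * localMaxwellian 1 (ϑ ^ 2) (v j) (v k)) /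
              ((∑ k ∈ (Finset.univ \ {i, j}), p k) * localMaxwellian 1 (θ + ϑ ^ 2) 0 (v j)) - 1|) +
      (2 * |(∑ k ∈ (Finset.univ \ {i, j}), p k * localMaxwellian 1 (ϑ ^ 2) (reflectVel ω (v i, v j)).1 (v k)) /
              ((∑ k ∈ (Finset.univ \ {i, j}), p k) * localMaxwellian 1 (θ + ϑ ^ 2) 0 (reflectVel ω (v i, v j)).1) - 1| +
         2 * ((p i + p j) * localMaxwellian 1 (ϑ ^ 2) (0 : V3) 0 /
              ((∑ k ∈ (Finset.univ \ {i, j}), p k) * localMaxwellian 1 (θ + ϑ ^ 2) 0 (reflectVel ω (v i, v j)).1))) +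
      (2 * |(∑ k ∈ (Finset.univ \ {i, j}), p k * localMaxwellian 1 (ϑ ^ 2) (reflectVel ω (v i, v j)).2 (v k)) /
              ((∑ k ∈ (Finset.univ \ {i, j}), p k) * localMaxwellian 1 (θ + ϑ ^ 2) 0 (reflectVel ω (v i, v j)).2) - 1| +
         2 * ((p i + p j) * localMaxwellian 1 (ϑ ^ 2) (0 : V3) 0 /
              ((∑ k ∈ (Finset.univ \ {i, j}), p k) * localMaxwellian 1 (θ + ϑ ^ 2) 0 (reflectVel ω (v i, v j)).2))) := by
  intro θ ϑ hθ hϑ n i j hij p hp0 hP ω v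
  set rest : Finset (Fin n) := Finset.univ \ {i, j} with hrest
  set P : ℝ := ∑ k ∈ rest, p k with hP_def
  set a : V3 := (reflectVel ω (v i, v j)).1 with ha_def
  set b : V3 := (reflectVel ω (v i, v j)).2 with hb_def
  set φ : V3 → V3 → ℝ := fun q u => localMaxwellian 1 (ϑ ^ 2) q u with hφ_def
  set m : V3 → ℝ := fun q => localMaxwellian 1 (θ + ϑ ^ 2) 0 q with hm_def
  set h0 : V3 → ℝ := fun q => ∑ k ∈ rest, p k * φ q (v k) with hh0_def
  set hm : V3 → ℝ := fun q => ∑ k, p k * φ q (v k) with hhm_def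
  set S : ℝ := (p i + p j) * localMaxwellian 1 (ϑ ^ 2) (0 : V3) 0 with hS_def
  have hϑ2 : 0 < ϑ ^ 2 := by positivity
  have hT : 0 < θ + ϑ ^ 2 := by positivity
  -- split of the full KDE into the leave-two-out part and the two self-spikes
  have hsplit : ∀ q, hm q = h0 q + (p i * φ q (v i) + p j * φ q (v j)) := by
    intro q
    have h1 := Finset.sum_sdiff (f := fun k => p k * φ q (v k)) (Finset.subset_univ ({i, j} : Finset (Fin n)))
    rw [Finset.sum_pair hij] at h1
    simp only [hhm_def, hh0_def, hrest]
    linarith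
  -- positivity of the leave-two-out part
  have hφpos : ∀ q u, 0 < φ q u := fun q u => localMaxwellian_pos one_pos hϑ2 _ _
  have hh0pos : ∀ q, 0 < h0 q := by
    intro q
    obtain ⟨k, hk, hpk⟩ : ∃ k ∈ rest, 0 < p k := by
      by_contra hcon
      push Not at hcon
      have : ∑ k ∈ rest, p k ≤ 0 := Finset.sum_nonpos fun k hk => hcon k hk
      linarith
    simp only [hh0_def]
    refine Finset.sum_pos' (fun l _ => mul_nonneg (hp0 l) (hφpos q _).le) ⟨k, hk, mul_pos hpk (hφpos q _)⟩
  have hmpos : ∀ q, 0 < m q := fun q => localMaxwellian_pos one_pos hT _ _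
  have hPm : ∀ q, 0 < P * m q := fun q => mul_pos hP (hmpos q)
  -- spikes
  have hspike_nn : ∀ q, 0 ≤ p i * φ q (v i) + p j * φ q (v j) :=
    fun q => add_nonneg (mul_nonneg (hp0 i) (hφpos q _).le) (mul_nonneg (hp0 j) (hφpos q _).le)
  have hspike_le : ∀ q, p i * φ q (v i) + p j * φ q (v j) ≤ S := by
    intro q
    simp only [hS_def, add_mul]
    exact add_le_add (mul_le_mul_of_nonneg_left (localMaxwellian_le_apply_zero hϑ2 _ _) (hp0 i))
      (mul_le_mul_of_nonneg_left (localMaxwellian_le_apply_zero hϑ2 _ _) (hp0 j))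
  have hS : 0 ≤ S := (hspike_nn a).trans (hspike_le a)
  -- balance of the reference at the four velocities
  have hbal : (P * m a) * (P * m b) = (P * m (v i)) * (P * m (v j)) := by
    have hen : ‖a‖ ^ 2 + ‖b‖ ^ 2 = ‖v i‖ ^ 2 + ‖v j‖ ^ 2 :=
      norm_sq_reflectVel_fst_add_norm_sq_reflectVel_snd ω (v i, v j)
    have := localMaxwellian_mul_eq_of_norm_sq (T := θ + ϑ ^ 2) hen
    simp only [hm_def]
    calc P * localMaxwellian 1 (θ + ϑ ^ 2) 0 a * (P * localMaxwellian 1 (θ + ϑ ^ 2) 0 b)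
        = P * P * (localMaxwellian 1 (θ + ϑ ^ 2) 0 a * localMaxwellian 1 (θ + ϑ ^ 2) 0 b) := by ring
      _ = P * P * (localMaxwellian 1 (θ + ϑ ^ 2) 0 (v i) * localMaxwellian 1 (θ + ϑ ^ 2) 0 (v j)) := by rw [this]
      _ = _ := by ring
  have key := metropolisDefect_le (ha := hm a) (hb := hm b) (hc := hm (v i)) (hd := hm (v j))
    (hh0a := hh0pos a) (hh0b := hh0pos b) (hh0c := hh0pos (v i)) (hh0d := hh0pos (v j))
    (hPm a) (hPm b) (hPm (v i)) (hPm (v j)) hbal hS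
    (by rw [hsplit a]; linarith [hspike_le a]) (by rw [hsplit b]; linarith [hspike_le b])
    (by rw [hsplit (v i)]; linarith [hspike_nn (v i)]) (by rw [hsplit (v j)]; linarith [hspike_nn (v j)])
    (by rw [hsplit a]; linarith [hh0pos a, hspike_nn a]) (by rw [hsplit b]; linarith [hh0pos b, hspike_nn b])
  exact key

end Summit.AtomisticToContinuum.HydrodynamicLimit.Theorems.OddContactSymmetryKineticSlab

end
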